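import Summits.QuantumFields.YangMills.Theorems.BalabanLadderIRDefectSquaring
import Summits.QuantumFields.YangMills.Theorems.BalabanLadderIRColdPurityBridge
import Literature.MathematicalPhysics.QuantumFieldTheory.WilsonFinTorusPartitionSymmetry
import HarnessLib

/-!
# Aspect-ratio bootstrap, part 3: the Wilson model — [Sym] and [Vol] supplied, `R` reduced to [TM-aniso]

Line `aspect-bootstrap` on crux `BalabanLadder.IR` (stmt-QuantumFields-19354, rung R2c; skeleton
`Cruxes/IR/Lines/aspect_bootstrap.lean` §2–§3).  Helper `--supports` the crux.

HONEST FRAMING.  Nothing here proves the Yang–Mills mass gap (Clay), the lattice gap, or `BalabanLadder.IR`; R4 closes only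
the conditional finite-𝕋⁴ rung `BalabanLadder.UV`.  This file wires the sorry-free abstract bootstrap `defectSquaring`
(part 2) to Wilson's anisotropic four-torus partition function `wilsonFinTorusPartition ρ β n₀ n₁ n₂ n₃`
(`Literature/MathematicalPhysics/QuantumFieldTheory/WilsonFinTorusPartition.lean`):
* `coldDefect_eq_boxDefect` — the cold defect of lines `floor-handshake` / `doubling-bridge`
  (`ColdPurityBridge.coldDefect`, landed) IS `boxDefect` of the Wilson family (`rfl`);
* [Sym] `axisSymmetric` and [Vol] `volumeBounds` — from the Literature theorems
  `wilsonFinTorusPartition_axisSymmetric` / `wilsonFinTorusPartition_volumeBounds` (`WilsonFinTorusPartitionSymmetry.lean`,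
  seat ym-ir-lit-4);
* `coldDoublingRecursionSC_of_model` — the three model facts ⇒ `ColdPurityBridge.ColdDoublingRecursionSC` with
  `C = squaringConst`, `β₀ = 0`, `L₀ = 8` (real proof, by `defectSquaring`);
* `coldDoublingRecursionSC_of_tracePositive` — the single remaining implication [TM-aniso] ⇒ `R`, where [TM-aniso] is the
  transfer-matrix trace formula `Z(b₁,b₂,b₃,m+2) = Σᵢ λᵢ^{m+2}` (`0 ≤ λᵢ ≤ λ_{i₀}`, `0 < λ_{i₀}`) for EVERY spatial box with
  sides `≥ 2` at `β ≥ 0` (`IsTracePositive`); the tree has the cubic case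
  (`exists_spectralData_wilsonFinTorusPartition`); the anisotropic case is the companion Literature work.
`R` carries no Yang–Mills difficulty; the weight of those lines stays in `H`/`E` and the residual `N`.

References: M. Lüscher, Commun. Math. Phys. 54 (1977) 283; K. Osterwalder, E. Seiler, Ann. Phys. 110 (1978) 440 §§2–3;
I. Montvay, G. Münster, *Quantum Fields on a Lattice* (1994) §3.2.6 (3.145).
-/

noncomputable section

open MeasureTheory
open Literature.MathematicalPhysics.QuantumFieldTheory Literature.MathematicalPhysics.QuantumLattice
open Summit.QuantumFields.YangMills.Cruxes.IR.ColdPurityBridge (coldDefect ColdDoublingRecursionSC)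

namespace Summit.QuantumFields.YangMills.Cruxes.IR.AspectBootstrap

section Model

variable {G : Type} [Group G] [TopologicalSpace G] [IsTopologicalGroup G] [CompactSpace G]
  [MeasurableSpace G] [BorelSpace G]

/-- `ColdPurityBridge.coldDefect` IS `boxDefect` of the Wilson family `wilsonFinTorusPartition ρ β` (definitional). -/
theorem coldDefect_eq_boxDefect {N : ℕ} (ρ : G →* Matrix (Fin N) (Fin N) ℂ) (β : ℝ) (L : ℕ) :
    coldDefect ρ β L = boxDefect (wilsonFinTorusPartition ρ β) L := rfl

/-- [Sym] for the model: axis-permutation symmetry of the anisotropic Wilson partition function of a lattice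
representation (the three transpositions `(0 3)`, `(0 1)`, `(0 2)`; Literature `wilsonFinTorusPartition_axisSymmetric`). -/
theorem axisSymmetric (r : LatticeRep G) (β : ℝ) : IsAxisSymmetric (wilsonFinTorusPartition r.ρ β) :=
  fun a b c d => wilsonFinTorusPartition_axisSymmetric r.ρ r.continuous β a b c d

/-- [Vol] for the model: `e^{−A·n₀n₁n₂n₃} ≤ Z ≤ 1` at `β ≥ 0` with `A = 12 N β` (Literature
`wilsonFinTorusPartition_volumeBounds`; second countability of `G` from the faithful matrix representation). -/
theorem volumeBounds (r : LatticeRep G) {β : ℝ} (hβ : 0 ≤ β) : HasVolumeBounds (wilsonFinTorusPartition r.ρ β) := by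
  haveI : SecondCountableTopology G :=
    (r.continuous.isClosedEmbedding r.injective).isEmbedding.secondCountableTopology
  obtain ⟨A, hA⟩ := wilsonFinTorusPartition_volumeBounds r.ρ r.continuous hβ
  exact ⟨A, fun a b c d _ _ _ _ => hA a b c d⟩

end Model

/-- **`R` from the three model facts** (real proof): if for every compact `G` (as quantified in
`ColdDoublingRecursionSC`), every lattice representation `r` and every `β ≥ 0` the Wilson family is axis-symmetric,
trace-positive and volume-bounded, then `ColdPurityBridge.ColdDoublingRecursionSC` holds with `C = squaringConst`,
`β₀ = 0`, `L₀ = 8` — by the sorry-free abstract bootstrap `defectSquaring`. -/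
theorem coldDoublingRecursionSC_of_model
    (hSym : ∀ (G : Type) [Group G] [TopologicalSpace G] [IsTopologicalGroup G] [CompactSpace G] [MeasurableSpace G]
      [BorelSpace G] (r : LatticeRep G) (β : ℝ), IsAxisSymmetric (wilsonFinTorusPartition r.ρ β))
    (hTM : ∀ (G : Type) [Group G] [TopologicalSpace G] [IsTopologicalGroup G] [CompactSpace G] [MeasurableSpace G]
      [BorelSpace G] (r : LatticeRep G) (β : ℝ), 0 ≤ β → IsTracePositive (wilsonFinTorusPartition r.ρ β))
    (hVol : ∀ (G : Type) [Group G] [TopologicalSpace G] [IsTopologicalGroup G] [CompactSpace G] [MeasurableSpace G]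
      [BorelSpace G] (r : LatticeRep G) (β : ℝ), 0 ≤ β → HasVolumeBounds (wilsonFinTorusPartition r.ρ β)) :
    ColdDoublingRecursionSC := by
  intro G _ _ _ _ _ _
  letI : MeasurableSpace G := borel G
  haveI : BorelSpace G := ⟨rfl⟩
  intro r
  refine ⟨squaringConst, 0, 8, squaringConst_pos, fun β hβ L hL L' h₁ h₂ => ?_⟩
  rw [coldDefect_eq_boxDefect, coldDefect_eq_boxDefect]
  exact defectSquaring (wilsonFinTorusPartition r.ρ β) (hSym G r β) (hTM G r β hβ) (hVol G r β hβ) L hL L' h₁ h₂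

/-- **[TM-aniso] ⇒ `R`**: the single remaining implication.  Given the transfer-matrix trace formula for every
anisotropic spatial box with sides `≥ 2` at `β ≥ 0` (`IsTracePositive (wilsonFinTorusPartition r.ρ β)`) for every compact
`G` and lattice representation `r`, the load `R = ColdPurityBridge.ColdDoublingRecursionSC` of lines `floor-handshake` /
`doubling-bridge` holds ([Sym] and [Vol] are the theorems `axisSymmetric`, `volumeBounds`). -/
theorem coldDoublingRecursionSC_of_tracePositive
    (hTM : ∀ (G : Type) [Group G] [TopologicalSpace G] [IsTopologicalGroup G] [CompactSpace G] [MeasurableSpace G]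
      [BorelSpace G] (r : LatticeRep G) (β : ℝ), 0 ≤ β → IsTracePositive (wilsonFinTorusPartition r.ρ β)) :
    ColdDoublingRecursionSC :=
  coldDoublingRecursionSC_of_model (fun _ _ _ _ _ _ _ r β => axisSymmetric r β) hTM
    (fun _ _ _ _ _ _ _ r _ hβ => volumeBounds r hβ)

end Summit.QuantumFields.YangMills.Cruxes.IR.AspectBootstrap

end
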